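/-
Copyright (c) 2026. All rights reserved.
Released under Apache 2.0 license as described in the file LICENSE.
Authors: abc-iut cell, fact-proving seat abc-iut-f-074 (block F, tranche 74; FACT-LIST rows F-0326,
F-0330, F-0331, F-0333 of abc-iut-L4-t9's `BiAnabelianTelecore.lean`, exact criterion).
-/
import Literature.AnabelianGeometry.AbsoluteAnabelian.AbsTopIII.BiAnabelianStarShadowCells
import Literature.AnabelianGeometry.AbsoluteAnabelian.LaxShadowFamilies

/-!
# [AbsTopIII] Cor 3.7 (ii)–(iv): the coherent system of `ι_×`-cells on the shadow of `𝒟*` and the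
# LAX family of homotopies on `𝒟*`

S. Mochizuki, *Topics in absolute anabelian geometry III* [MochizukiAbsTopIII2015] (kurims manuscript
`paper:url-5493eb38cbb7`), Cor 3.7 (ii)–(iv) pp. 87–88; Def 3.5 (ii) p. 75.

PROOF-ONLY companion (technical) of `BiAnabelianTelecore.lean` (abc-iut-L4-t9), continuing
`BiAnabelianStarShadowCells.lean`.  On abc-iut-L4-t12's pseudo-commuting shadow `deltaShadow θ` of
`𝒟*` we assemble a COHERENT SYSTEM OF SHADOW 2-CELLS (`LaxShadowFamilies.lean`, `PseudoShadow.LaxCells`):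

* the relation `StarCellRel`: a co-verticial pair `([γ₁],[γ₂])` is related iff the two paths have the
  same λ-type, or `γ₁` passes through `λ^×` and `γ₂` through `λ^{×pf}` (saturated:
  `starCellRel_isSaturated`);
* its 2-cells `starσ`: `eqToHom` (equal shadows) in the first case, the `ι_×`-cell `iotaP` in the second
  (well defined because `iotaP` does not depend on the path within a λ-type: `iotaP_transport`), with the
  identity / composition / whiskering laws of Def 3.5 (ii) on the shadow;
* `starLaxCells θ`, and **the lax family `starLaxFamily θ` on `𝒟*`**: ONE family of homotopies whose
  boundary set contains ALL pairs pinned in Cor 3.7 (ii)–(iv) — the generators of `ℋ_δ`, the telecore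
  homotopy of `𝔗_δ`, and the two kinds of `𝔖†_log`-pairs; its homotopies are identified in
  `BiAnabelianTelecoreIncompatibilityIff.lean`, where the exact criterion for Cor 3.7 (iv) is proved.

Refereed pre-IUT anabelian geometry; bookkeeping over abstract data; nothing here bears on [IUTchIII]
Cor. 3.12; no side taken.
-/

set_option autoImplicit false

namespace Literature.AnabelianGeometry.AbsoluteAnabelian

open CategoryTheory Quiver DiagramOfCategories

universe w u

namespace AbsTopIII

/-! ## The relation: equal λ-types, or `λ^×` versus `λ^{×pf}` -/

/-- The pairs of paths on `Γ⃗_{𝒟*}` carrying a shadow 2-cell: co-verticial pairs with the SAME λ-type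
(equal shadows), and pairs (`γ₁` through `λ^×`, `γ₂` through `λ^{×pf}`) (shadows related by `ι_×`).
[cite: MochizukiAbsTopIII2015, Cor 3.7 (iii) p.88] -/
inductive StarCellRel : ∀ ⦃a b : Cor37Vertex⦄, StarPath.{w} a b → StarPath.{w} a b → Prop
  | ofEq {a b : Cor37Vertex} {p q : StarPath.{w} a b} (h : starLamType p = starLamType q) :
      StarCellRel p q
  | iota {a b : Cor37Vertex} {p q : StarPath.{w} a b} (hp : starLamType p = some true)
      (hq : starLamType q = some false) : StarCellRel p q

namespace StarCellRel

/-- The λ-types of a related pair with different λ-types. [cite: MochizukiAbsTopIII2015, Cor 3.7 (iii) p.88] -/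
theorem types_of_ne {a b : Cor37Vertex} {p q : StarPath.{w} a b} (h : StarCellRel p q)
    (hne : starLamType p ≠ starLamType q) : starLamType p = some true ∧ starLamType q = some false := by
  cases h with
  | ofEq h => exact absurd h hne
  | iota hp hq => exact ⟨hp, hq⟩

end StarCellRel

/-- `StarCellRel` is a saturated set of co-verticial pairs (Section 0: diagonal, composition, pre- and
post-composition with arbitrary paths). [cite: MochizukiAbsTopIII2015, Section 0 p.26] -/
theorem starCellRel_isSaturated : IsSaturated (StarCellRel.{w}) where
  refl_left _ _ _ _ _ := StarCellRel.ofEq rfl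
  refl_right _ _ _ _ _ := StarCellRel.ofEq rfl
  trans _ _ p q r h₁ h₂ := by
    cases h₁ with
    | ofEq h₁ =>
      cases h₂ with
      | ofEq h₂ => exact StarCellRel.ofEq (h₁.trans h₂)
      | iota hp hq => exact StarCellRel.iota (h₁.trans hp) hq
    | iota hp hq =>
      cases h₂ with
      | ofEq h₂ => exact StarCellRel.iota hp (h₂ ▸ hq)
      | iota hp' hq' => rw [hq] at hp'; cases hp'
  precomp _ _ _ p q h r := by
    cases h with
    | ofEq h => exact StarCellRel.ofEq (by rw [starLamType_comp, starLamType_comp, h])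
    | iota hp hq =>
      exact StarCellRel.iota (by rw [starLamType_comp, hp]; rfl) (by rw [starLamType_comp, hq]; rfl)
  postcomp _ _ _ p q h r := by
    cases h with
    | ofEq h => exact StarCellRel.ofEq (by rw [starLamType_comp, starLamType_comp, h])
    | iota hp hq =>
      cases hr : starLamType r with
      | none =>
        exact StarCellRel.iota (by rw [starLamType_comp, hr, hp]; rfl)
          (by rw [starLamType_comp, hr, hq]; rfl)
      | some t => exact StarCellRel.ofEq (by rw [starLamType_comp, starLamType_comp, hr]; rfl)

namespace BiAnabelianSetting

variable {X E N : Type u} [Category.{u} X] [Category.{u} E] [Category.{u} N]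
  (𝔖 : BiAnabelianSetting X E N) (θ : FiberSquare.BiAnabelianLift 𝔖.gal)

/-! ## The `ι_×`-cell does not depend on the path within a λ-type -/

/-- Components of a natural transformation at propositionally equal objects agree heterogeneously.
[folklore] -/
private theorem app_heq' {C D : Type u} [Category.{u} C] [Category.{u} D] {F G : C ⥤ D} (α : F ⟶ G)
    {x y : C} (h : x = y) : α.app x ≍ α.app y := by
  subst h; rfl

/-- A functor preserves heterogeneous equality of morphisms with equal endpoints. [folklore] -/
private theorem map_heq' {C D : Type u} [Category.{u} C] [Category.{u} D] (F : C ⥤ D) {x y x' y' : C}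
    (hx : x = x') (hy : y = y') {f : x ⟶ y} {g : x' ⟶ y'} (h : f ≍ g) : F.map f ≍ F.map g := by
  subst hx hy; cases h; rfl

/-- Two `eqToHom`s with equal domains are heterogeneously equal. [folklore] -/
private theorem eqToHom_heq_eqToHom {C : Type*} [Category C] {a b c d : C} (h : a = b) (h' : c = d)
    (e : a = c) : eqToHom h ≍ eqToHom h' := by
  subst h h' e; rfl

/-- Natural transformations between equal functors with heterogeneously equal components are
heterogeneously equal. [folklore] -/
private theorem natTrans_heq_of_app {C D : Type u} [Category.{u} C] [Category.{u} D]
    {F F' G G' : C ⥤ D} (hF : F = F') (hG : G = G') (α : F ⟶ G) (β : F' ⟶ G')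
    (h : ∀ x, α.app x ≍ β.app x) : α ≍ β := by
  subst hF hG
  exact heq_of_eq (NatTrans.ext (funext fun x => eq_of_heq (h x)))

/-- The component of the `ι_×`-cell of a path `[γ]∘[λ^×]` into `𝒩` is (heterogeneously) `ι_×` itself.
[cite: MochizukiAbsTopIII2015, Cor 3.7 (iii) p.88] -/
theorem iotaP_cons_lamTimes_app_heq {a : Cor37Vertex} (p : StarPath.{u} a .box)
    (y : (𝔖.deltaShadow θ).Sh a) :
    (𝔖.iotaP θ (p.cons Cor37Edge.lamTimes)).app y ≍
      𝔖.iotaTimes.app (((𝔖.deltaShadow θ).shP (starFlip p)).obj y) := by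
  rw [iotaP_cons_app, 𝔖.iotaP_eq_eqToHom θ p
    (by simp [starLamType_eq_none_of_row p (by simp [Cor37Vertex.row])]), eqToHom_app, eqToHom_map]
  exact eqToHom_comp_heq _ _

/-- The components of the `ι_×`-cell of a path into `𝒩` depend only on its λ-type.
[cite: MochizukiAbsTopIII2015, Cor 3.7 (iii) p.88] -/
theorem iotaP_app_heq_space {a : Cor37Vertex} (p p₂ : StarPath.{u} a .space)
    (h : starLamType p = starLamType p₂) (y : (𝔖.deltaShadow θ).Sh a) :
    (𝔖.iotaP θ p).app y ≍ (𝔖.iotaP θ p₂).app y := by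
  by_cases ht : starLamType p = some true
  · have ht₂ : starLamType p₂ = some true := h ▸ ht
    cases p with
    | nil => simp [starLamType] at ht
    | cons p e =>
      cases e with
      | lamTimesPf => simp [starLamType, Cor37Edge.lamType] at ht
      | lamTimes =>
        cases p₂ with
        | nil => exact absurd (Cor37Vertex.row_le_of_path p) (by simp [Cor37Vertex.row])
        | cons p₂ e₂ =>
          cases e₂ with
          | lamTimesPf => simp [starLamType, Cor37Edge.lamType] at ht₂
          | lamTimes =>
            exact (𝔖.iotaP_cons_lamTimes_app_heq θ p y).trans
              ((app_heq' 𝔖.iotaTimes (Functor.congr_obj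
                (𝔖.shP_eq_of_row θ (starFlip p) (starFlip p₂) (by simp [Cor37Vertex.row])) y)).trans
                (𝔖.iotaP_cons_lamTimes_app_heq θ p₂ y).symm)
  · rw [𝔖.iotaP_eq_eqToHom θ p ht, 𝔖.iotaP_eq_eqToHom θ p₂ (fun h₂ => ht (h.trans h₂)), eqToHom_app,
      eqToHom_app]
    exact eqToHom_heq_eqToHom _ _ (Functor.congr_obj (𝔖.shP_eq_of_starLamType_eq θ p p₂ h) y)

/-- **The components of the `ι_×`-cell depend only on the λ-type of the path** (heterogeneous form).
[cite: MochizukiAbsTopIII2015, Cor 3.7 (iii) p.88] -/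
theorem iotaP_app_heq {a b : Cor37Vertex} (p p₂ : StarPath.{u} a b)
    (h : starLamType p = starLamType p₂) (y : (𝔖.deltaShadow θ).Sh a) :
    (𝔖.iotaP θ p).app y ≍ (𝔖.iotaP θ p₂).app y := by
  by_cases ht : starLamType p = some true
  · cases b with
    | first n => exact absurd (starLamType_eq_none_of_row p (by simp [Cor37Vertex.row])) (by simp [ht])
    | box => exact absurd (starLamType_eq_none_of_row p (by simp [Cor37Vertex.row])) (by simp [ht])
    | ref => exact absurd (starLamType_eq_none_of_row p (by simp [Cor37Vertex.row])) (by simp [ht])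
    | space => exact 𝔖.iotaP_app_heq_space θ p p₂ h y
    | galois =>
      cases p with
      | nil => simp [starLamType] at ht
      | cons p e =>
        cases e
        cases p₂ with
        | nil => exact absurd (Cor37Vertex.row_le_of_path p) (by simp [Cor37Vertex.row])
        | cons p₂ e₂ =>
          cases e₂
          simp only [starLamType, Cor37Edge.lamType, Option.none_or] at h
          rw [iotaP_cons_app, iotaP_cons_app]
          have hs := Functor.congr_obj (𝔖.shP_eq_space θ p p₂ h) y
          have ht' := Functor.congr_obj (𝔖.shP_eq_of_starLamType_eq θ (starFlip p) (starFlip p₂)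
            (by rw [starLamType_flip, starLamType_flip, h])) y
          exact heq_comp (congrArg _ hs) (congrArg _ ht') (congrArg _ ht')
            (map_heq' _ hs ht' (𝔖.iotaP_app_heq_space θ p p₂ h y)) (app_heq' _ ht')
  · rw [𝔖.iotaP_eq_eqToHom θ p ht, 𝔖.iotaP_eq_eqToHom θ p₂ (fun h₂ => ht (h.trans h₂)), eqToHom_app,
      eqToHom_app]
    exact eqToHom_heq_eqToHom _ _ (Functor.congr_obj (𝔖.shP_eq_of_starLamType_eq θ p p₂ h) y)

/-- **The `ι_×`-cell depends only on the λ-type of the path**: for co-verticial `γ`, `γ₂` of the same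
λ-type, `ι_γ` is `ι_{γ₂}` conjugated by the `eqToHom`s of the equal shadows.
[cite: MochizukiAbsTopIII2015, Cor 3.7 (iii) p.88] -/
theorem iotaP_transport {a b : Cor37Vertex} (p p₂ : StarPath.{u} a b)
    (h : starLamType p = starLamType p₂) :
    𝔖.iotaP θ p = eqToHom (𝔖.shP_eq_of_starLamType_eq θ p p₂ h) ≫ 𝔖.iotaP θ p₂ ≫
      eqToHom (𝔖.shP_eq_of_starLamType_eq θ (starFlip p₂) (starFlip p)
        (by rw [starLamType_flip, starLamType_flip, h])) :=
  (conj_eqToHom_iff_heq' _ _ _ _).mpr (natTrans_heq_of_app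
    (𝔖.shP_eq_of_starLamType_eq θ p p₂ h)
    (𝔖.shP_eq_of_starLamType_eq θ (starFlip p) (starFlip p₂)
      (by rw [starLamType_flip, starLamType_flip, h])) _ _
    fun y => 𝔖.iotaP_app_heq θ p p₂ h y)

/-! ## The shadow 2-cells and their laws -/

/-- **The shadow 2-cell of a related pair**: the `eqToHom` of the equal shadows when the λ-types agree,
the `ι_×`-cell followed by an `eqToHom` otherwise. [cite: MochizukiAbsTopIII2015, Cor 3.7 (iii) p.88] -/
noncomputable def starσ {a b : Cor37Vertex} {p q : StarPath.{u} a b} (h : StarCellRel p q) :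
    ((𝔖.deltaShadow θ).shP p ⟶ (𝔖.deltaShadow θ).shP q) :=
  if e : starLamType p = starLamType q then eqToHom (𝔖.shP_eq_of_starLamType_eq θ p q e)
  else 𝔖.iotaP θ p ≫ eqToHom (𝔖.shP_eq_of_starLamType_eq θ (starFlip p) q
    (by rw [starLamType_flip, (h.types_of_ne e).1, (h.types_of_ne e).2]; rfl))

/-- The shadow 2-cell of a pair with equal λ-types. [cite: MochizukiAbsTopIII2015, Cor 3.7 (iii) p.88] -/
theorem starσ_of_eq {a b : Cor37Vertex} {p q : StarPath.{u} a b} (h : StarCellRel p q)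
    (e : starLamType p = starLamType q) :
    𝔖.starσ θ h = eqToHom (𝔖.shP_eq_of_starLamType_eq θ p q e) := by
  simp [starσ, e]

/-- The shadow 2-cell of a pair `λ^×` versus `λ^{×pf}`. [cite: MochizukiAbsTopIII2015, Cor 3.7 (iii) p.88] -/
theorem starσ_of_ne {a b : Cor37Vertex} {p q : StarPath.{u} a b} (h : StarCellRel p q)
    (e : starLamType p ≠ starLamType q) :
    𝔖.starσ θ h = 𝔖.iotaP θ p ≫ eqToHom (𝔖.shP_eq_of_starLamType_eq θ (starFlip p) q
      (by rw [starLamType_flip, (h.types_of_ne e).1, (h.types_of_ne e).2]; rfl)) := by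
  simp [starσ, e]

/-- Axiom `ζ_{([γ],[γ])} = id` on the shadow. [cite: MochizukiAbsTopIII2015, Definition 3.5 (ii) p.75] -/
theorem starσ_refl {a b : Cor37Vertex} {p : StarPath.{u} a b} (h : StarCellRel p p) :
    𝔖.starσ θ h = 𝟙 _ := by
  rw [𝔖.starσ_of_eq θ h rfl, eqToHom_refl]

/-- Axiom `ζ_{ϖ''} = ζ_{ϖ'} ∘ ζ_ϖ` on the shadow. [cite: MochizukiAbsTopIII2015, Definition 3.5 (ii) p.75] -/
theorem starσ_trans {a b : Cor37Vertex} {p q r : StarPath.{u} a b} (h₁ : StarCellRel p q)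
    (h₂ : StarCellRel q r) :
    𝔖.starσ θ (starCellRel_isSaturated.trans h₁ h₂) = 𝔖.starσ θ h₁ ≫ 𝔖.starσ θ h₂ := by
  by_cases e₁ : starLamType p = starLamType q
  · by_cases e₂ : starLamType q = starLamType r
    · rw [𝔖.starσ_of_eq θ _ (e₁.trans e₂), 𝔖.starσ_of_eq θ h₁ e₁, 𝔖.starσ_of_eq θ h₂ e₂]
      exact (eqToHom_trans _ _).symm
    · have e₃ : starLamType p ≠ starLamType r := fun e => e₂ (e₁.symm.trans e)
      rw [𝔖.starσ_of_ne θ _ e₃, 𝔖.starσ_of_eq θ h₁ e₁, 𝔖.starσ_of_ne θ h₂ e₂,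
        𝔖.iotaP_transport θ p q e₁]
      simp only [Category.assoc]
      congr 2
      exact eqToHom_trans _ _
  · by_cases e₂ : starLamType q = starLamType r
    · have e₃ : starLamType p ≠ starLamType r := fun e => e₁ (e.trans e₂.symm)
      rw [𝔖.starσ_of_ne θ _ e₃, 𝔖.starσ_of_ne θ h₁ e₁, 𝔖.starσ_of_eq θ h₂ e₂]
      simp only [Category.assoc]
      congr 1
      exact (eqToHom_trans _ _).symm
    · exact absurd ((h₁.types_of_ne e₁).2.symm.trans (h₂.types_of_ne e₂).1) (by simp)

/-- `f ≫ eqToHom = eqToHom ≫ (g ≫ eqToHom) ≫ eqToHom` for heterogeneously equal `f`, `g`. [folklore] -/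
private theorem comp_eqToHom_eq_of_heq {C : Type*} [Category C] {a b c a' b' b'' : C}
    {f : a ⟶ b} {g : a' ⟶ b'} (H : f ≍ g) (h₁ : b = c) (h₂ : a = a') (h₃ : b' = b'') (h₄ : b'' = c) :
    f ≫ eqToHom h₁ = eqToHom h₂ ≫ (g ≫ eqToHom h₃) ≫ eqToHom h₄ := by
  subst h₂ h₃ h₄ h₁
  cases H
  simp

/-- Whiskering axiom on the shadow (componentwise): the 2-cell of `([γ₃]∘[γ₁]∘[γ₄],[γ₃]∘[γ₂]∘[γ₄])` is
`sh_[γ₄]` applied to the 2-cell of `([γ₁],[γ₂])` taken at `sh_[γ₃](y)`.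
[cite: MochizukiAbsTopIII2015, Definition 3.5 (ii) p.75] -/
theorem starσ_whisker_app {a b c d : Cor37Vertex} {p q : StarPath.{u} a b} (h : StarCellRel p q)
    (r₁ : StarPath.{u} c a) (r₂ : StarPath.{u} b d) (y : (𝔖.deltaShadow θ).Sh c) :
    (𝔖.starσ θ (starCellRel_isSaturated.precomp (starCellRel_isSaturated.postcomp h r₂) r₁)).app y =
      eqToHom (by rw [(𝔖.deltaShadow θ).shP_comp_obj, (𝔖.deltaShadow θ).shP_comp_obj]) ≫
        ((𝔖.deltaShadow θ).shP r₂).map ((𝔖.starσ θ h).app (((𝔖.deltaShadow θ).shP r₁).obj y)) ≫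
        eqToHom (by rw [(𝔖.deltaShadow θ).shP_comp_obj, (𝔖.deltaShadow θ).shP_comp_obj]) := by
  by_cases e : starLamType p = starLamType q
  · have e' : starLamType (r₁.comp (p.comp r₂)) = starLamType (r₁.comp (q.comp r₂)) := by
      rw [starLamType_comp, starLamType_comp, starLamType_comp, starLamType_comp, e]
    rw [𝔖.starσ_of_eq θ _ e', 𝔖.starσ_of_eq θ h e, eqToHom_app, eqToHom_app, eqToHom_map]
    exact (conj_eqToHom_iff_heq' _ _ _ _).mpr (eqToHom_heq_eqToHom _ _
      (by rw [(𝔖.deltaShadow θ).shP_comp_obj, (𝔖.deltaShadow θ).shP_comp_obj]))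
  · obtain ⟨hp, hq⟩ := h.types_of_ne e
    have ha : a.row ≤ 2 := row_le_two_of_starLamType p hp
    have hb : 3 ≤ b.row := by
      by_contra hb
      rw [starLamType_eq_none_of_row p (by omega)] at hp
      cases hp
    have hr₁ : starLamType r₁ = none := starLamType_eq_none_of_row r₁ ha
    have hr₂ : starLamType r₂ = none := starLamType_eq_none_of_source hb r₂
    have e' : starLamType (r₁.comp (p.comp r₂)) ≠ starLamType (r₁.comp (q.comp r₂)) := by
      rw [starLamType_comp, starLamType_comp, starLamType_comp, starLamType_comp, hp, hq, hr₁, hr₂]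
      simp
    -- the `ι_×`-cell of the whiskered path, through the composition law
    have H : (𝔖.iotaP θ (r₁.comp (p.comp r₂))).app y ≍
        ((𝔖.deltaShadow θ).shP r₂).map ((𝔖.iotaP θ p).app (((𝔖.deltaShadow θ).shP r₁).obj y)) := by
      refine (𝔖.iotaP_comp_app_heq θ r₁ (p.comp r₂) y).trans ?_
      rw [𝔖.iotaP_eq_eqToHom θ r₁ (by simp [hr₁]), eqToHom_app, eqToHom_map]
      refine (eqToHom_comp_heq _ _).trans ?_
      refine (𝔖.iotaP_comp_app_heq θ p r₂ _).trans ?_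
      rw [𝔖.iotaP_eq_eqToHom θ r₂ (by simp [hr₂]), eqToHom_app]
      refine (comp_eqToHom_heq _ _).trans ?_
      have hz : ((𝔖.deltaShadow θ).shP (starFlip r₁)).obj y = ((𝔖.deltaShadow θ).shP r₁).obj y := by
        rw [starFlip_eq_self r₁ (by simp [hr₁])]
      exact map_heq' _ (congrArg _ hz) (congrArg _ hz) (app_heq' _ hz)
    rw [𝔖.starσ_of_ne θ _ e', 𝔖.starσ_of_ne θ h e, NatTrans.comp_app, NatTrans.comp_app, eqToHom_app,
      eqToHom_app, Functor.map_comp, eqToHom_map]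
    exact comp_eqToHom_eq_of_heq H _ _ _ _

/-! ## The coherent system and the lax family on `𝒟*` -/

/-- **The coherent system of shadow 2-cells of `𝒟*`** on abc-iut-L4-t12's `deltaShadow θ`: relation
`StarCellRel`, 2-cells `starσ`, all terminal vertices admissible.
[cite: MochizukiAbsTopIII2015, Cor 3.7 (iii) p.88] -/
noncomputable def starLaxCells : (𝔖.deltaShadow θ).LaxCells where
  R := fun _ _ p q => StarCellRel p q
  isSaturated := starCellRel_isSaturated
  good := fun _ => True
  good_of := fun _ _ _ _ _ => trivial
  σ := fun _ _ _ _ h => 𝔖.starσ θ h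
  σ_refl := fun _ _ _ h => 𝔖.starσ_refl θ h
  σ_trans := fun _ _ _ _ _ h₁ h₂ => 𝔖.starσ_trans θ h₁ h₂
  σ_whisker_app := fun _ _ _ _ _ _ h r₁ r₂ y => 𝔖.starσ_whisker_app θ h r₁ r₂ y

/-- **The lax family of homotopies on `𝒟*`** determined by `θ^bi`: boundary set `StarCellRel` (every
co-verticial pair with equal λ-types, and every pair `λ^×` versus `λ^{×pf}`), homotopies the lax universal
homotopies over the shadow 2-cells `starσ` (augmentations fully faithful by t12's `deltaFF`).
[cite: MochizukiAbsTopIII2015, Cor 3.7 (iv) p.88] -/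
noncomputable def starLaxFamily : 𝔖.starDiagram.HomotopyFamily :=
  (𝔖.deltaShadow θ).laxFamily (𝔖.starLaxCells θ) (fun b _ => 𝔖.deltaFF θ b)

/-- The boundary set of the lax family is `StarCellRel`. [cite: MochizukiAbsTopIII2015, Cor 3.7 (iv) p.88] -/
theorem starLaxFamily_E {a b : Cor37Vertex} (p q : StarPath.{u} a b) :
    (𝔖.starLaxFamily θ).E p q ↔ StarCellRel p q := Iff.rfl

end BiAnabelianSetting

end AbsTopIII

end Literature.AnabelianGeometry.AbsoluteAnabelian
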